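import Summits.BirchSwinnertonDyer.Rank1Residual.Supersingular.X7KolyvaginRoadUpperHalf
import Summits.BirchSwinnertonDyer.Rank1Residual.Supersingular.X7TwistClauseOPEN
import Summits.BirchSwinnertonDyer.Rank1Residual.X2.TwistTamagawa
import Literature.NumberTheory.EllipticCurves.MatarNekovar2019.ShaIndexBoundIrreducible
import Literature.NumberTheory.EllipticCurves.NonvanishingTwistsPrescribedSplitting
import Literature.NumberTheory.EllipticCurves.Rank1Residual.ClassX1KellerYinTypeA
import HarnessLib

/-!
# Class X7 (good supersingular odd `p`, `E` NOT semistable), analytic rank `1`, NO IMAGE HYPOTHESIS: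
# the UPPER half of `BSD(E,p)` from Kolyvagin's bound in Matar–Nekovář's IRREDUCIBLE form and the
# rank-zero LOWER bound of a Heegner twist (cell `bsd-ssimc`, seat `bsd-ssimc-lev`, gen 2 = the
# planner's «lev gen 1»; order T-lev-UH of `HOME/TARGET.md` v5 §1.2/§6.3; companion of
# `X7KolyvaginRoadUpperHalf.lean`, p400932; sequel `X7LowerHalvesOnly.lean` does rank `0` and both ranks)

HONEST FRAMING (cell `bsd-ssimc`, `run/shared/lean/pub/bsd-ssimc/README.md`, row A7 = X7 = N5 / O4;
PARTITION: X7 (A7) × 38 r0 classes + 1 184 r1 cells (book230, N < 5·10⁵) × odd ss p —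
types-the-object-of; closes none): THEOREMS ONLY (no definition, no named fact, no `sorry`); nothing
about any curve is asserted; nothing booked; X7 stays CONSTRUCTION-SHAPED.

## What this file records

p400932 obtained the UPPER half `ord_p #Ш(E) ≤ ord_p #Ш(E)_an` on X7 ∧ {r_an = 1} ∧ {p ≥ 5} from
Kolyvagin 1990 over `K` under `ρ̄_{E,p}` ONTO (`Kolyvagin1990_padicValNat_card_sha_le`) plus the
rank-zero lower bound for the Heegner twist. Here `Surj W p` is REMOVED and `p ≥ 5` relaxed to
`p` odd, following the additive sub-cell's X4(M) files (`RankOneIrreducibleLowerHalves`,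
`RankZeroHeegnerLowerTwist`): the `Ш(E/K)`-bound is taken in Matar–Nekovář's form (JTNB 31 (2019)
Thm. 0.3 + §0.4 + §0.11 + Cor. 5.21 (e′) + Prop. 5.26 (2): `ord_p #Ш(E/K) ≤ 2·ord_p [E(K):ℤy_K]` for
`p` odd, `E[p]` IRREDUCIBLE, `d_K ≠ −3, −4`; tree fact
`MatarNekovar2019.thm03_padicValNat_card_sha_le_of_irreducible`), and irreducibility is automatic on
X7 (`ClassX7.irr`). The Heegner field is taken with `2` AND `p` split and `|d_K| > 4`
(Friedberg–Hoffstein with prescribed splitting, `friedbergHoffstein_exists_heegnerField_splitDivisors_twist_ne_zero`,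
`M = 2p`), so that `d_K` is odd and square-free, `d_K < −4` (`w_K = 2`, `d_K ≠ −3, −4`), the odd-`p`
Tamagawa transport `X2.padicValNat_tamagawaProduct_twist_of_heegner_of_odd` applies (every odd `p`,
in particular `p = 3`), and the globally minimal model `Wd` of `E^{(d_K)}` is AGAIN AN X7 PAIR at `p`
(`classX7_twist_of_heegner`: good supersingular at `p ∤ 2d_K`; additive at the odd primes of `d_K`,
where `E` is good) — so the typed input can be indexed by X7 membership of the twist itself.

* `odd_discr_and_lt_of_two_split`, `classX7_twist_of_heegner` — bookkeeping: `2` split and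
  `|d_K| > 4` give `d_K` odd, `d_K < −4`; `GoodSS` is carried to the Heegner twist, which is never
  semistable (so X7 is twist-stable under Heegner twisting and X6 is carried INTO X7).
* `missingUpperBoundAt_of_twistLowerBound_of_matarNekovar_of_irr` — r_an = 1, pointwise at a
  Manin-unit Heegner datum, ANY odd good `p`, `E[p]` irreducible, `d_K` odd, `d_K ≠ −3, −4`,
  `p ∤ ∏c(E)`: the UPPER half from Matar–Nekovář + the rank-zero LOWER bound of the twist; X7 reading
  `X7.missingUpperBoundAt_of_twistLowerBound_of_matarNekovar_of_irr` (= p400932's theorem with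
  `Kolyvagin1990_…` → `MatarNekovar2019.thm03_…`, `Surj` → `ClassX7.irr`).
* `X7.missingUpperBoundAt_of_twistLowerBound_of_analyticRank_eq_one` — class level, r_an = 1, odd
  `p`, `p ∤ ∏c(E)`, NO `Surj`: UPPER half ⇐ LOWER halves of the rank-ZERO X7 quadratic twists of `E`
  (N5-type typed input), everything else PUBLISHED by name.
* `X7.bsdp_of_lower_of_twistLowerBound_of_analyticRank_eq_one` — `BSD(E,p)` ⇐ that + the pair's own
  lower half (from the signed main conjecture + BKO Cor. A.5, or from STEP L — not chosen here).

What is NOT here: `p ∣ ∏c(E)` (Kolyvagin's bound is blind to the Tamagawa term over `K`); `p = 2`;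
any assertion of a lower half; rank `0` (sequel file).

References: [MatarNekovar2019] Thm. 0.3, §0.4, §0.11, Cor. 5.21, Prop. 5.26; [KolyvaginEulerSystems1990]
Cor. 13; [GrossZagier1986] Thm. I.6.3; [JetchevSkinnerWan2017] §7.4.1–7.4.2; [FriedbergHoffstein1995]
Thm. B; [Mazur1978] Cor. 4.1; [SilvermanAEC2009] VII.1 Rem. 1.1, VII.5 Prop. 5.1; [SilvermanATAEC1994]
IV.9 Table 4.1; [Knapp1993] Prop. 12.10; [Miller2011LMS] Def. 1.1.
-/

noncomputable section

open scoped Classical MatrixGroups ModularForm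

open CongruenceSubgroup WeierstrassCurve NumberField Literature.NumberTheory.EllipticCurves
  Literature.NumberTheory.EllipticCurves.ModularForms
  Literature.NumberTheory.EllipticCurves.Rank1Residual
  Literature.NumberTheory.EllipticCurves.Rank1Residual.Typed

namespace Summit.BirchSwinnertonDyer.Rank1Residual.Supersingular

/-! ### §0 The Heegner twist of an X7 pair is an X7 pair -/

section TwistClass

/-- **A Heegner field with `2` split and `|d_K| > 4` has `d_K` odd and `d_K < −4`** (so `d_K` is
square-free, `d_K ≠ −3, −4`, `w_K = 2`). Bookkeeping. [folklore] -/
theorem odd_discr_and_lt_of_two_split (K : Type) [Field K] [NumberField K]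
    (hK : IsImaginaryQuadratic K) (h2 : SatisfiesHeegnerHypothesis 2 K)
    (hB : 4 < (NumberField.discr K).natAbs) :
    Odd (NumberField.discr K) ∧ NumberField.discr K < -4 := by
  have h2' : ¬ ((2 : ℕ) : ℤ) ∣ NumberField.discr K :=
    Literature.SatisfiesHeegnerHypothesis.not_dvd_discr hK.1 h2 Nat.prime_two (dvd_refl 2)
  haveI : IsTotallyComplex K := hK.2
  have hneg : NumberField.discr K < 0 := discr_neg_of_finrank_eq_two K hK.1
  refine ⟨?_, by omega⟩
  rw [← Int.not_even_iff_odd, even_iff_two_dvd]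
  exact_mod_cast h2'

/-- **The Heegner twist of a good-supersingular pair is an X7 pair.** Let `W/ℚ` be globally minimal
with good supersingular reduction at the odd prime `p` (`GoodSS W p`), `K` imaginary quadratic
satisfying the Heegner hypothesis for `N_E`, with `2` and `p` split and `|d_K| > 4`, and `Wd` a
globally minimal model of `E^{(d_K)}`. Then `(Wd, p) ∈ X7`: `d_K` is odd (hence square-free) with
`p ∤ 2d_K`, so `Wd` is good supersingular at `p` (`goodSS_of_smul_eq_quadraticTwist`, Silverman VII.5
Prop. 5.1(a) + `a_p(Wd) = (d_K/p)·a_p(W)`); and `|d_K| ≥ 5` odd has an odd prime factor `q`, which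
is ramified in `K`, hence `q ∤ N_E` (split primes are unramified), so `E` is good at `q` and `Wd` is
ADDITIVE at `q` (type `I₀*`; `not_semistable_of_smul_eq_quadraticTwist_of_odd_prime_dvd`). In
particular X7 is stable under Heegner twisting and X6 is carried INTO X7.
[cite: SilvermanAEC2009, VII.5 Prop. 5.1(a),(c) and VII.1 Remark 1.1] [cite: Knapp1993, Prop. 12.10] -/
theorem classX7_twist_of_heegner (W : WeierstrassCurve ℚ) [W.IsElliptic] [W.IsGloballyMinimal]
    (p : ℕ) [Fact p.Prime] (hp2 : p ≠ 2) (hss : GoodSS W p)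
    (K : Type) [Field K] [NumberField K] (hK : IsImaginaryQuadratic K)
    (hHN : SatisfiesHeegnerHypothesis (W.conductorNorm ℤ) K) (h2 : SatisfiesHeegnerHypothesis 2 K)
    (hHp : SatisfiesHeegnerHypothesis p K) (hB : 4 < (NumberField.discr K).natAbs)
    (Wd : WeierstrassCurve ℚ) [Wd.IsElliptic] [Wd.IsGloballyMinimal] (Cd : VariableChange ℚ)
    (hWd : Cd • W.quadraticTwist (NumberField.discr K : ℚ) = Wd) : ClassX7 Wd p := by
  have hp : p.Prime := Fact.out
  obtain ⟨hodd, hdK⟩ := odd_discr_and_lt_of_two_split K hK h2 hB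
  have hsq : Squarefree (NumberField.discr K) := squarefree_discr_of_odd hK hodd
  have hpd : ¬ (p : ℤ) ∣ NumberField.discr K :=
    Literature.SatisfiesHeegnerHypothesis.not_dvd_discr hK.1 hHp hp dvd_rfl
  have hp2d : ¬ (p : ℤ) ∣ 2 * NumberField.discr K := by
    intro h
    rcases (Nat.prime_iff_prime_int.mp hp).dvd_or_dvd h with h2' | hd
    · have : p ∣ 2 := by exact_mod_cast h2'
      exact hp2 ((Nat.prime_dvd_prime_iff_eq hp Nat.prime_two).mp this)
    · exact hpd hd
  have hC : Cd⁻¹ • Wd = W.quadraticTwist (NumberField.discr K : ℚ) := by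
    rw [← hWd, inv_smul_smul]
  refine ⟨goodSS_of_smul_eq_quadraticTwist W Wd p hss hsq hC hp2d, ?_⟩
  -- an odd prime `q ∣ d_K`; `E` is good at `q` (the Heegner hypothesis: `q ∣ N_E ⇒ q` split `⇒ q ∤ d_K`)
  have hne1 : (NumberField.discr K).natAbs ≠ 1 := by omega
  obtain ⟨q, hq, hqd⟩ := Nat.exists_prime_and_dvd hne1
  haveI : Fact q.Prime := ⟨hq⟩
  have hqdZ : (q : ℤ) ∣ NumberField.discr K := Int.natCast_dvd.mpr hqd
  have hq2 : q ≠ 2 := by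
    rintro rfl
    obtain ⟨m, hm⟩ := hodd
    obtain ⟨k, hk⟩ := hqdZ
    omega
  have hgoodq : W.HasGoodReductionAtPrime q := by
    by_contra hbad
    have hqN : q ∣ W.conductorNorm ℤ :=
      (W.dvd_conductorNorm_iff_not_hasGoodReductionAtPrime q).mpr hbad
    exact Literature.SatisfiesHeegnerHypothesis.not_dvd_discr hK.1 hHN hq hqN hqdZ
  exact not_semistable_of_smul_eq_quadraticTwist_of_odd_prime_dvd W Wd hsq hC hq2 hqdZ hgoodq

end TwistClass

/-! ### §1 Analytic rank ONE, pointwise: the UPPER half from Matar–Nekovář + the twist's lower bound -/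

section RankOne

variable (W : WeierstrassCurve ℚ) [W.IsElliptic] [W.IsGloballyMinimal] (p : ℕ) [Fact p.Prime]

/-- **The UPPER half at fixed Heegner data, r_an = 1, ANY odd good prime `p`, `E[p]` IRREDUCIBLE (no
surjectivity), `p ∤ ∏c(E)`, from Matar–Nekovář (`hMN`, PUBLISHED) and the typed LOWER bound for the
rank-zero twist (`hlowd`).** Data as in p400932's `X7.missingUpperBoundAt_of_twistLowerBound_of_kolyvagin_of_surj`
with `K` of ODD discriminant `d_K ≠ −3, −4` (so the odd-`p` Tamagawa transport
`X2.padicValNat_tamagawaProduct_twist_of_heegner_of_odd` applies and Kolyvagin's `D_K ≠ −3, −4` holds);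
`hMN` = Matar–Nekovář 2019 Thm. 0.3/§0.11 for `(N_E, W, K)`; `hlowd : Typed.MissingLowerBoundAt Wd p`
for the globally minimal twist model `Wd = Cd • E^{(d_K)}` (an X7 pair of analytic rank `0` when
`2` splits in `K`, `classX7_twist_of_heegner`). CONCLUSION: `Typed.MissingUpperBoundAt W p`. Via
`X11b.missingUpperBoundAt_of_shaIndexBound`. Class-agnostic (X6 or X7 at `p`); CONDITIONAL on `hlowd`;
nothing booked. [cite: MatarNekovar2019, Thm. 0.3 (p. 456), §0.4, §0.11 (p. 457), Cor. 5.21 (e′), Prop. 5.26 (2)]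
[cite: JetchevSkinnerWan2017, §7.4.2 (eq:shaupper), p. 31] [cite: Miller2011LMS, Def. 1.1] -/
theorem missingUpperBoundAt_of_twistLowerBound_of_matarNekovar_of_irr
    [NeZero (W.conductorNorm ℤ)] (K : Type) [Field K] [NumberField K]
    (Dt : ModularParametrizationData W (W.conductorNorm ℤ))
    (H : HeegnerDatum (W.conductorNorm ℤ) (NumberField.discr K)) (ι : K →+* ℂ)
    (P : (W.baseChange K).toAffine.Point)
    -- the published inputs (named facts of the tree)
    (hGZ : gross_zagier (W.conductorNorm ℤ) W K) (hKo : kolyvagin (W.conductorNorm ℤ) W K)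
    (hMN : MatarNekovar2019.thm03_padicValNat_card_sha_le_of_irreducible (W.conductorNorm ℤ) W K)
    (hGZK : rank_eq_analyticRank_of_analyticRank_le_one) (hmod : hasEntireLFunction_rat)
    -- the pair
    (hp2 : p ≠ 2) (hgood : W.HasGoodReductionAtPrime p) (hirr : Irr W p) (hr : W.analyticRank = 1)
    (htam0 : ¬ p ∣ W.tamagawaProduct)
    -- the Heegner data
    (hK : IsImaginaryQuadratic K) (hHN : SatisfiesHeegnerHypothesis (W.conductorNorm ℤ) K)
    (hHp : SatisfiesHeegnerHypothesis p K) (hodd : Odd (NumberField.discr K))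
    (hD3 : NumberField.discr K ≠ -3) (hD4 : NumberField.discr K ≠ -4)
    (hP : WeierstrassCurve.Affine.Point.map ι.toRatAlgHom P = heegnerPointComplex Dt H)
    (hc : ¬ (p : ℤ) ∣ Dt.c) (hμ : ¬ p ∣ Units.torsionOrder K)
    (hLt : (W.quadraticTwist (NumberField.discr K : ℚ)).entireLFunction 1 ≠ 0)
    (Wd : WeierstrassCurve ℚ) [Wd.IsElliptic] [Wd.IsGloballyMinimal] (Cd : VariableChange ℚ)
    (hWd : Cd • W.quadraticTwist (NumberField.discr K : ℚ) = Wd)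
    -- the typed input: the rank-zero LOWER bound for the twist
    (hlowd : MissingLowerBoundAt Wd p) :
    MissingUpperBoundAt W p := by
  have hp : p.Prime := Fact.out
  have hD0 : (NumberField.discr K : ℚ) ≠ 0 := by exact_mod_cast NumberField.discr_ne_zero K
  haveI hEt : (W.quadraticTwist (NumberField.discr K : ℚ)).IsElliptic :=
    W.isElliptic_quadraticTwist hD0
  have hpd : ¬ (p : ℤ) ∣ NumberField.discr K :=
    Literature.SatisfiesHeegnerHypothesis.not_dvd_discr hK.1 hHp hp dvd_rfl
  have hgoodd : Wd.HasGoodReductionAtPrime p := good_twist_model W p hp2 hpd hgood Cd hWd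
  have htam : padicValNat p Wd.tamagawaProduct = padicValNat p W.tamagawaProduct :=
    X2.padicValNat_tamagawaProduct_twist_of_heegner_of_odd W p hp2 K hK hodd hpd hHN Cd hWd
  have hu : padicValRat p (Cd.u : ℚ) = 0 :=
    X11b.padicValRat_u_eq_zero_of_twist_good W p hpd hgood Cd hWd hgoodd
  -- the twist has analytic rank `0`
  have hLt' : (W.quadraticTwist (NumberField.discr K : ℚ)).entireLFunction = Wd.entireLFunction := by
    rw [← hWd, entireLFunction_smul]
  have hLd1 : Wd.entireLFunction 1 ≠ 0 := by rw [← hLt']; exact hLt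
  have hrd : Wd.analyticRank = 0 := (Wd.analyticRank_eq_zero_iff_holds (hmod Wd)).2 hLd1
  have htw := ge_half_of_missingLowerBoundAt_of_analyticRank_eq_zero hGZK Wd p hrd hLd1 hlowd
  -- Matar–Nekovář's bound over `K` (`E[p]` irreducible, `d_K ≠ −3, −4`)
  have hU : Finite (W.baseChange K).sha → ¬ IsOfFinAddOrder P →
      padicValNat p (Nat.card (W.baseChange K).sha) ≤
        2 * padicValNat p (AddSubgroup.zmultiples P).index :=
    fun _ hnt ↦ hMN hK hHN hD3 hD4 ⟨Dt, H, ι, hP⟩ hnt hp hp2 hirr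
  exact X11b.missingUpperBoundAt_of_shaIndexBound W p (W.conductorNorm ℤ) K Dt H ι P hGZ hKo hGZK
    hmod hK hHN hP hp2 hc hμ hr hLt Wd Cd hWd hu htam htam0 htw hU

/-- **X7 reading of the pointwise theorem** (order T-lev-UH: p400932's
`X7.missingUpperBoundAt_of_twistLowerBound_of_kolyvagin_of_surj` with
`Kolyvagin1990_padicValNat_card_sha_le` → `MatarNekovar2019.thm03_…_of_irreducible` and `Surj W p` →
`ClassX7.irr`): on X7 ∧ {r_an = 1} at an odd `p ∤ ∏c(E)`, Heegner field with `d_K` odd, `≠ −3, −4`,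
the UPPER half from the rank-zero LOWER bound of the twist. NO surjectivity. [cite: MatarNekovar2019, Thm. 0.3 (p. 456), §0.11 (p. 457)]
[cite: JetchevSkinnerWan2017, §7.4.2 (eq:shaupper), p. 31] -/
theorem X7.missingUpperBoundAt_of_twistLowerBound_of_matarNekovar_of_irr
    [NeZero (W.conductorNorm ℤ)] (K : Type) [Field K] [NumberField K]
    (Dt : ModularParametrizationData W (W.conductorNorm ℤ))
    (H : HeegnerDatum (W.conductorNorm ℤ) (NumberField.discr K)) (ι : K →+* ℂ)
    (P : (W.baseChange K).toAffine.Point)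
    (hGZ : gross_zagier (W.conductorNorm ℤ) W K) (hKo : kolyvagin (W.conductorNorm ℤ) W K)
    (hMN : MatarNekovar2019.thm03_padicValNat_card_sha_le_of_irreducible (W.conductorNorm ℤ) W K)
    (hGZK : rank_eq_analyticRank_of_analyticRank_le_one) (hmod : hasEntireLFunction_rat)
    (hp2 : p ≠ 2) (hX : ClassX7 W p) (hr : W.analyticRank = 1) (htam0 : ¬ p ∣ W.tamagawaProduct)
    (hK : IsImaginaryQuadratic K) (hHN : SatisfiesHeegnerHypothesis (W.conductorNorm ℤ) K)
    (hHp : SatisfiesHeegnerHypothesis p K) (hodd : Odd (NumberField.discr K))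
    (hD3 : NumberField.discr K ≠ -3) (hD4 : NumberField.discr K ≠ -4)
    (hP : WeierstrassCurve.Affine.Point.map ι.toRatAlgHom P = heegnerPointComplex Dt H)
    (hc : ¬ (p : ℤ) ∣ Dt.c) (hμ : ¬ p ∣ Units.torsionOrder K)
    (hLt : (W.quadraticTwist (NumberField.discr K : ℚ)).entireLFunction 1 ≠ 0)
    (Wd : WeierstrassCurve ℚ) [Wd.IsElliptic] [Wd.IsGloballyMinimal] (Cd : VariableChange ℚ)
    (hWd : Cd • W.quadraticTwist (NumberField.discr K : ℚ) = Wd)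
    (hlowd : MissingLowerBoundAt Wd p) :
    MissingUpperBoundAt W p :=
  Supersingular.missingUpperBoundAt_of_twistLowerBound_of_matarNekovar_of_irr W p K Dt H ι P hGZ hKo
    hMN hGZK hmod hp2 hX.1.1 (ClassX7.irr W p hp2 hX) hr htam0 hK hHN hHp hodd hD3 hD4 hP hc hμ hLt Wd
    Cd hWd hlowd

/-- **X7 ∧ {r_an = 1}, ANY odd `p`, `p ∤ ∏c(E)`, NO image hypothesis, class level: the UPPER half
`ord_p #Ш(E) ≤ ord_p #Ш(E)_an` from the LOWER halves of the rank-ZERO X7 quadratic twists of `E`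
(`hTw`, N5-type typed input), everything else PUBLISHED by name** (Gross–Zagier `hGZ`, Kolyvagin
`hKo`, Matar–Nekovář `hMN`, GZK `hGZK`, modularity `hmod`/`hnf`, Friedberg–Hoffstein with prescribed
splitting `hFH`, Mazur 1978 Cor. 4.1 `hMaz`, Néron `hNS`). The field: `w(E) = −1`, so `hFH` with
`M = 2p`, `B = 4` gives `K` Heegner for `N_E` with `2` and `p` split, `|d_K| > 4`, `L(E^{(d_K)},1) ≠ 0`;
the Manin-unit datum by `X11b.exists_maninDatum_of_good` (irreducibility from `ClassX7.irr`); the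
twist's minimal model is an X7 pair of analytic rank `0` (`classX7_twist_of_heegner`), so `hTw`
applies; then the pointwise theorem. CONDITIONAL on `hTw`; nothing booked; X7 unchanged.
[cite: MatarNekovar2019, Thm. 0.3 (p. 456), §0.11 (p. 457)] [cite: FriedbergHoffstein1995, Thm. B]
[cite: JetchevSkinnerWan2017, §7.4.1–7.4.2] [cite: Mazur1978, Cor. 4.1] [cite: Miller2011LMS, Def. 1.1] -/
theorem X7.missingUpperBoundAt_of_twistLowerBound_of_analyticRank_eq_one
    (hGZ : ∀ (N : ℕ) [NeZero N] (W : WeierstrassCurve ℚ) (K : Type) [Field K] [NumberField K],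
      gross_zagier N W K)
    (hKo : ∀ (N : ℕ) [NeZero N] (W : WeierstrassCurve ℚ) (K : Type) [Field K] [NumberField K],
      kolyvagin N W K)
    (hMN : ∀ (N : ℕ) [NeZero N] (W : WeierstrassCurve ℚ) (K : Type) [Field K] [NumberField K],
      MatarNekovar2019.thm03_padicValNat_card_sha_le_of_irreducible N W K)
    (hGZK : rank_eq_analyticRank_of_analyticRank_le_one) (hmod : hasEntireLFunction_rat)
    (hnf : exists_isNewformOf)
    (hFH : friedbergHoffstein_exists_heegnerField_splitDivisors_twist_ne_zero)
    (hMaz : mazur_not_dvd_maninConstant_of_odd) (hNS : integral_neronScaling_of_isGloballyMinimal)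
    -- typed input: the rank-zero LOWER bound for the X7 quadratic twists of `E`
    (hTw : ∀ (V : WeierstrassCurve ℚ) [V.IsElliptic] [V.IsGloballyMinimal], ClassX7 V p →
      V.analyticRank = 0 → (∃ (d : ℤ) (C : VariableChange ℚ), C • V = W.quadraticTwist (d : ℚ)) →
      MissingLowerBoundAt V p)
    (hp2 : p ≠ 2) (hX : ClassX7 W p) (hr : W.analyticRank = 1) (htam0 : ¬ p ∣ W.tamagawaProduct) :
    MissingUpperBoundAt W p := by
  have hp : p.Prime := Fact.out
  have hgood : W.HasGoodReductionAtPrime p := hX.1.1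
  have hirr : Irr W p := ClassX7.irr W p hp2 hX
  haveI : NeZero (W.conductorNorm ℤ) := ⟨(W.conductorNorm_pos_holds).ne'⟩
  -- the sign of the functional equation is `−1` (modularity, `r_an = 1`)
  have hw : W.rootNumber = -1 := by
    rw [WeierstrassCurve.rootNumber_eq_neg_one_pow_analyticRank_of_exists_isNewformOf hnf W, hr]
    norm_num
  -- the Friedberg–Hoffstein field with `2` and `p` split, `|d_K| > 4`
  obtain ⟨K, _, _, hK, hB, hHN, hH2p, hLt⟩ := hFH W hw (2 * p) (mul_ne_zero two_ne_zero hp.ne_zero) 4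
  have h2 : SatisfiesHeegnerHypothesis 2 K := SatisfiesHeegnerHypothesis.of_dvd (dvd_mul_right 2 p) hH2p
  have hHp : SatisfiesHeegnerHypothesis p K := SatisfiesHeegnerHypothesis.of_dvd (dvd_mul_left p 2) hH2p
  obtain ⟨hodd, hdK⟩ := odd_discr_and_lt_of_two_split K hK h2 hB
  have hμ : ¬ p ∣ Units.torsionOrder K := by
    rw [Literature.NumberTheory.DiophantineGeometry.torsionOrder_eq_two_of_discr_lt hK.1 hdK]
    intro hd
    exact hp2 ((Nat.prime_dvd_prime_iff_eq hp Nat.prime_two).mp hd)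
  -- the Manin-unit Heegner datum at a good odd prime (irreducible `E[p]`)
  obtain ⟨Dt, H, ι, P, hP, hc⟩ :=
    X11b.exists_maninDatum_of_good hnf hMaz hNS W p (W.conductorNorm ℤ) K rfl hp2 hgood hirr hK hHN
  -- a globally minimal model of the twist: an X7 pair of analytic rank `0`
  have hD0 : (NumberField.discr K : ℚ) ≠ 0 := by exact_mod_cast NumberField.discr_ne_zero K
  haveI hEt : (W.quadraticTwist (NumberField.discr K : ℚ)).IsElliptic :=
    W.isElliptic_quadraticTwist hD0
  obtain ⟨Cd, hCd⟩ := hasGlobalMinimalModel_rat_holds (W.quadraticTwist (NumberField.discr K : ℚ))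
  haveI : (Cd • W.quadraticTwist (NumberField.discr K : ℚ)).IsGloballyMinimal := hCd
  set Wd := Cd • W.quadraticTwist (NumberField.discr K : ℚ) with hWd_def
  have hWd : Cd • W.quadraticTwist (NumberField.discr K : ℚ) = Wd := rfl
  have hXd : ClassX7 Wd p := classX7_twist_of_heegner W p hp2 hX.1 K hK hHN h2 hHp hB Wd Cd hWd
  have hLt' : (W.quadraticTwist (NumberField.discr K : ℚ)).entireLFunction = Wd.entireLFunction := by
    rw [← hWd, entireLFunction_smul]
  have hLd1 : Wd.entireLFunction 1 ≠ 0 := by rw [← hLt']; exact hLt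
  have hrd : Wd.analyticRank = 0 := (Wd.analyticRank_eq_zero_iff_holds (hmod Wd)).2 hLd1
  have hC : Cd⁻¹ • Wd = W.quadraticTwist (NumberField.discr K : ℚ) := by
    rw [← hWd, inv_smul_smul]
  have hlowd : MissingLowerBoundAt Wd p := hTw Wd hXd hrd ⟨NumberField.discr K, Cd⁻¹, hC⟩
  exact Supersingular.missingUpperBoundAt_of_twistLowerBound_of_matarNekovar_of_irr W p K Dt H ι P
    (hGZ _ W K) (hKo _ W K) (hMN _ W K) hGZK hmod hp2 hgood hirr hr htam0 hK hHN hHp hodd (by omega)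
    (by omega) hP hc hμ hLt Wd Cd hWd hlowd

/-- **X7 ∧ {r_an = 1}, ANY odd `p`, `p ∤ ∏c(E)`, NO image hypothesis: `BSD(E,p)` from LOWER halves
alone** — the pair's own (`hlow : Typed.MissingLowerBoundAt W p`, e.g. from the signed main conjecture
+ BKO Cor. A.5, or from STEP L) and those of its rank-zero X7 quadratic twists (`hTw`), every other
input PUBLISHED by name. Assembly by `X11b.bsdp_of_halves`. CONDITIONAL on the typed inputs; nothing
booked. [cite: MatarNekovar2019, Thm. 0.3 (p. 456), §0.11 (p. 457)] [cite: FriedbergHoffstein1995, Thm. B]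
[cite: Miller2011LMS, §1 and Def. 1.1] -/
theorem X7.bsdp_of_lower_of_twistLowerBound_of_analyticRank_eq_one
    (hGZ : ∀ (N : ℕ) [NeZero N] (W : WeierstrassCurve ℚ) (K : Type) [Field K] [NumberField K],
      gross_zagier N W K)
    (hKo : ∀ (N : ℕ) [NeZero N] (W : WeierstrassCurve ℚ) (K : Type) [Field K] [NumberField K],
      kolyvagin N W K)
    (hMN : ∀ (N : ℕ) [NeZero N] (W : WeierstrassCurve ℚ) (K : Type) [Field K] [NumberField K],
      MatarNekovar2019.thm03_padicValNat_card_sha_le_of_irreducible N W K)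
    (hGZK : rank_eq_analyticRank_of_analyticRank_le_one) (hmod : hasEntireLFunction_rat)
    (hnf : exists_isNewformOf)
    (hFH : friedbergHoffstein_exists_heegnerField_splitDivisors_twist_ne_zero)
    (hMaz : mazur_not_dvd_maninConstant_of_odd) (hNS : integral_neronScaling_of_isGloballyMinimal)
    (hTw : ∀ (V : WeierstrassCurve ℚ) [V.IsElliptic] [V.IsGloballyMinimal], ClassX7 V p →
      V.analyticRank = 0 → (∃ (d : ℤ) (C : VariableChange ℚ), C • V = W.quadraticTwist (d : ℚ)) →
      MissingLowerBoundAt V p)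
    (hp2 : p ≠ 2) (hX : ClassX7 W p) (hr : W.analyticRank = 1) (htam0 : ¬ p ∣ W.tamagawaProduct)
    (hlow : MissingLowerBoundAt W p) : BSDp W p :=
  X11b.bsdp_of_halves hGZK W p (by omega) hlow
    (X7.missingUpperBoundAt_of_twistLowerBound_of_analyticRank_eq_one W p hGZ hKo hMN hGZK hmod hnf
      hFH hMaz hNS hTw hp2 hX hr htam0)

end RankOne

end Summit.BirchSwinnertonDyer.Rank1Residual.Supersingular

end
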